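import Summits.NavierStokesRegularity.OSWSelfSimilar.MoebiusAdaptedCircleMap
import HarnessLib

/-!
# Chain-rule identities of the Möbius-adapted circle map `Θ_s(y) = 2 arctan(s tan(y/2))` in the mapped variable

MODEL-side kernel companion of the ns-blowup profile programme (zone Z3, case Z3-U TWIN, engine «u5t», seat ns-blowup-profile-eng-5;
HOME/profile/z3twin/ENGINE-E5.md §11–§12). `MoebiusAdaptedCircleMap.lean` (p492477) proved `Θ_s′(y) = 2s/((1 + s²) + (1 − s²) cos y) = P_ρ(y)`
in the PHYSICAL variable `y = x − x_c`; the engine, which works on the uniform grid of the MAPPED variable `θ = Θ_s(y)`, uses the same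
facts written in `θ` with the «engine denominator» `D(θ) = (s² + 1) + (s² − 1) cos θ`:

* `cos_moebiusAngle`, `sin_moebiusAngle` — `cos Θ_s(y) = ((1 − s²) + (1 + s²) cos y)/((1 + s²) + (1 − s²) cos y)`,
  `sin Θ_s(y) = 2s sin y/((1 + s²) + (1 − s²) cos y)`;
* `engineDenom_moebiusAngle_mul` — `D(Θ_s(y)) · ((1 + s²) + (1 − s²) cos y) = 4s²`, hence
  `hasDerivAt_moebiusAngle_engineDenom` — `Θ_s′(y) = D(Θ_s(y))/(2s)` and the chain rule `(g ∘ Θ_s)′ = (D/2s) g′ ∘ Θ_s`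
  (`hasDerivAt_comp_moebiusAngle`: the engine's `ω_x∘X = (D/2s) g_θ`), with the second-order term
  `hasDerivAt_engineDenom_comp` — `d/dy [D(Θ_s(y))/(2s)] = −(s² − 1) sin(Θ_s y) D(Θ_s y)/(4s²)` (the engine's `θ_xx`), whence
  the engine's `ω_xx∘X = (D/2s)² g_θθ − ((s² − 1) sin θ D/4s²) g_θ` (`hasDerivAt_deriv_comp_moebiusAngle`);
* `moebiusAngle_inv_comp` — the inverse map is `Θ_{1/s}`: `Θ_s(Θ_{s⁻¹}(θ)) = θ` on `(−π, π)`; `hasDerivAt_moebiusAngle_inv` — `X′(θ) = 2s/D(θ)`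
  (the engine's `(u∘X)_θ = (u_x∘X)·2s/D`); `hasDerivAt_moebiusAngle_inv_param` — `∂_s Θ_{s⁻¹}(θ) = −2 sin θ/D(θ)`, i.e. `∂_t X = ẋ_c − (ṡ/s)·2s sin θ/D`,
  which with `ω_x∘X = (D/2s) g_θ` is the engine's transport term `−g_θ sin θ (ṡ/s)`.

All statements hold off the pole line `cos(y/2) = 0` (resp. `cos(θ/2) = 0`), where Lean's `tan` takes a junk value. WHAT THIS IS NOT: not NS —
elementary calculus about the change of variables of a numerical engine for a 1-D MODEL. No definitions, no named facts.
-/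

noncomputable section

namespace Summit.NavierStokesRegularity.OSWSelfSimilar.MoebiusAngleChainRule

open Summit.NavierStokesRegularity.OSWSelfSimilar.MoebiusAdaptedCircleMap Set
open scoped Real

/-! ### `cos` and `sin` of the mapped angle -/

/-- `cos(2 arctan q) = (1 − q²)/(1 + q²)` (helper). [folklore] -/
private theorem cos_two_arctan (q : ℝ) : Real.cos (2 * Real.arctan q) = (1 - q ^ 2) / (1 + q ^ 2) := by
  have hq2 : (0 : ℝ) < 1 + q ^ 2 := by positivity
  rw [Real.cos_two_mul, Real.cos_sq_arctan]
  field_simp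
  ring

/-- `sin(2 arctan q) = 2q/(1 + q²)` (helper). [folklore] -/
private theorem sin_two_arctan (q : ℝ) : Real.sin (2 * Real.arctan q) = 2 * q / (1 + q ^ 2) := by
  have hq2 : (0 : ℝ) < 1 + q ^ 2 := by positivity
  have hsq : Real.sqrt (1 + q ^ 2) ^ 2 = 1 + q ^ 2 := Real.sq_sqrt hq2.le
  have hsc : Real.sin (Real.arctan q) * Real.cos (Real.arctan q) = q / (1 + q ^ 2) := by
    rw [Real.sin_arctan, Real.cos_arctan, div_mul_div_comm, mul_one, ← pow_two, hsq]
  rw [Real.sin_two_mul, mul_assoc, hsc]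
  ring

/-- Half-angle bookkeeping: with `C = cos(y/2) ≠ 0`, `S = sin(y/2)`: `cos y = C² − S²`, `sin y = 2SC`, `S² + C² = 1` (helper). [folklore] -/
private theorem half_angle (y : ℝ) :
    Real.cos y = Real.cos (y / 2) ^ 2 - Real.sin (y / 2) ^ 2 ∧ Real.sin y = 2 * Real.sin (y / 2) * Real.cos (y / 2) := by
  constructor
  · have h := Real.cos_two_mul (y / 2)
    rw [show 2 * (y / 2) = y by ring] at h
    nlinarith [Real.sin_sq_add_cos_sq (y / 2)]
  · have h := Real.sin_two_mul (y / 2)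
    rwa [show 2 * (y / 2) = y by ring] at h

/-- **`cos` of the mapped angle**: `cos Θ_s(y) = ((1 − s²) + (1 + s²) cos y)/((1 + s²) + (1 − s²) cos y)` for `cos(y/2) ≠ 0`. [folklore] -/
theorem cos_moebiusAngle (s : ℝ) {y : ℝ} (hy : Real.cos (y / 2) ≠ 0) :
    Real.cos (moebiusAngle s y) = ((1 - s ^ 2) + (1 + s ^ 2) * Real.cos y) / ((1 + s ^ 2) + (1 - s ^ 2) * Real.cos y) := by
  obtain ⟨hc, _⟩ := half_angle y
  set C := Real.cos (y / 2) with hC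
  set S := Real.sin (y / 2) with hS
  have hCS : S ^ 2 + C ^ 2 = 1 := Real.sin_sq_add_cos_sq (y / 2)
  have htan : Real.tan (y / 2) = S / C := Real.tan_eq_sin_div_cos _
  unfold moebiusAngle
  rw [cos_two_arctan, htan, hc]
  have hnum : (1 - s ^ 2) + (1 + s ^ 2) * (C ^ 2 - S ^ 2) = 2 * (C ^ 2 - s ^ 2 * S ^ 2) := by
    linear_combination (s ^ 2 - 1) * hCS
  have hden : (1 + s ^ 2) + (1 - s ^ 2) * (C ^ 2 - S ^ 2) = 2 * (C ^ 2 + s ^ 2 * S ^ 2) := by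
    linear_combination (-(1 + s ^ 2)) * hCS
  rw [hnum, hden]
  have hC2 : C ^ 2 + s ^ 2 * S ^ 2 ≠ 0 := by positivity
  field_simp

/-- **`sin` of the mapped angle**: `sin Θ_s(y) = 2s sin y/((1 + s²) + (1 − s²) cos y)` for `cos(y/2) ≠ 0`. [folklore] -/
theorem sin_moebiusAngle (s : ℝ) {y : ℝ} (hy : Real.cos (y / 2) ≠ 0) :
    Real.sin (moebiusAngle s y) = 2 * s * Real.sin y / ((1 + s ^ 2) + (1 - s ^ 2) * Real.cos y) := by
  obtain ⟨hc, hsn⟩ := half_angle y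
  set C := Real.cos (y / 2) with hC
  set S := Real.sin (y / 2) with hS
  have hCS : S ^ 2 + C ^ 2 = 1 := Real.sin_sq_add_cos_sq (y / 2)
  have htan : Real.tan (y / 2) = S / C := Real.tan_eq_sin_div_cos _
  unfold moebiusAngle
  rw [sin_two_arctan, htan, hc, hsn]
  have hden : (1 + s ^ 2) + (1 - s ^ 2) * (C ^ 2 - S ^ 2) = 2 * (C ^ 2 + s ^ 2 * S ^ 2) := by
    linear_combination (-(1 + s ^ 2)) * hCS
  rw [hden]
  have hC2 : C ^ 2 + s ^ 2 * S ^ 2 ≠ 0 := by positivity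
  field_simp

/-! ### The engine denominator `D(θ) = (s² + 1) + (s² − 1) cos θ` and the first derivative -/

/-- **`D(Θ_s(y)) · ((1 + s²) + (1 − s²) cos y) = 4s²`**: the engine denominator at the mapped angle times the physical-side denominator
is constant (`cos(y/2) ≠ 0`). [folklore] -/
theorem engineDenom_moebiusAngle_mul (s : ℝ) {y : ℝ} (hy : Real.cos (y / 2) ≠ 0) :
    ((s ^ 2 + 1) + (s ^ 2 - 1) * Real.cos (moebiusAngle s y)) * ((1 + s ^ 2) + (1 - s ^ 2) * Real.cos y) = 4 * s ^ 2 := by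
  rw [cos_moebiusAngle s hy]
  obtain ⟨hc, _⟩ := half_angle y
  have hCS : Real.sin (y / 2) ^ 2 + Real.cos (y / 2) ^ 2 = 1 := Real.sin_sq_add_cos_sq (y / 2)
  have hD2 : (1 + s ^ 2) + (1 - s ^ 2) * Real.cos y ≠ 0 := by
    have : (1 + s ^ 2) + (1 - s ^ 2) * Real.cos y = 2 * Real.cos (y / 2) ^ 2 + 2 * s ^ 2 * Real.sin (y / 2) ^ 2 := by
      rw [hc]; linear_combination (-(1 + s ^ 2)) * hCS
    rw [this]; positivity
  field_simp
  ring

/-- **`Θ_s′ = D(Θ_s)/(2s)`**: for `s > 0` and `cos(y/2) ≠ 0`, `HasDerivAt (moebiusAngle s) (((s² + 1) + (s² − 1) cos(Θ_s y))/(2s)) y` — the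
derivative of the map written in the mapped variable (from `hasDerivAt_moebiusAngle`, p492477, and `engineDenom_moebiusAngle_mul`). [folklore] -/
theorem hasDerivAt_moebiusAngle_engineDenom {s y : ℝ} (hs : 0 < s) (hy : Real.cos (y / 2) ≠ 0) :
    HasDerivAt (moebiusAngle s) (((s ^ 2 + 1) + (s ^ 2 - 1) * Real.cos (moebiusAngle s y)) / (2 * s)) y := by
  refine (hasDerivAt_moebiusAngle hs hy).congr_deriv ?_
  have hD : (1 + s ^ 2) + (1 - s ^ 2) * Real.cos y ≠ 0 := (moebiusDenom_pos hs y).ne'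
  have hs0 : s ≠ 0 := hs.ne'
  have h := engineDenom_moebiusAngle_mul s hy
  field_simp
  linear_combination (-1 : ℝ) * h

/-- **Chain rule, first order** (the engine's `ω_x∘X = (D/2s) g_θ`): if `g` has derivative `g′` at `θ = Θ_s(y)`, then `y ↦ g(Θ_s y)` has
derivative `(D(θ)/(2s)) · g′` at `y` (`s > 0`, `cos(y/2) ≠ 0`). [folklore] -/
theorem hasDerivAt_comp_moebiusAngle {s y : ℝ} (hs : 0 < s) (hy : Real.cos (y / 2) ≠ 0) {g : ℝ → ℝ} {g' : ℝ}
    (hg : HasDerivAt g g' (moebiusAngle s y)) :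
    HasDerivAt (fun x => g (moebiusAngle s x))
      (((s ^ 2 + 1) + (s ^ 2 - 1) * Real.cos (moebiusAngle s y)) / (2 * s) * g') y := by
  have h := hg.comp y (hasDerivAt_moebiusAngle_engineDenom hs hy)
  refine h.congr_deriv ?_
  ring

/-! ### The second-order term -/

/-- Derivative of the Jacobian factor: `d/dy [D(Θ_s y)/(2s)] = −(s² − 1) sin θ · D(θ)/(4s²)`, `θ = Θ_s(y)` — the engine's
coefficient `θ_xx = −(s² − 1) sin θ D/(4s²)` (`s > 0`, `cos(y/2) ≠ 0`). [folklore] -/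
theorem hasDerivAt_engineDenom_comp {s y : ℝ} (hs : 0 < s) (hy : Real.cos (y / 2) ≠ 0) :
    HasDerivAt (fun x => ((s ^ 2 + 1) + (s ^ 2 - 1) * Real.cos (moebiusAngle s x)) / (2 * s))
      (-(s ^ 2 - 1) * Real.sin (moebiusAngle s y)
          * ((s ^ 2 + 1) + (s ^ 2 - 1) * Real.cos (moebiusAngle s y)) / (4 * s ^ 2)) y := by
  have hθ := hasDerivAt_moebiusAngle_engineDenom hs hy
  have hcos : HasDerivAt (fun x => Real.cos (moebiusAngle s x))
      (-Real.sin (moebiusAngle s y) * (((s ^ 2 + 1) + (s ^ 2 - 1) * Real.cos (moebiusAngle s y)) / (2 * s))) y :=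
    (Real.hasDerivAt_cos _).comp y hθ
  have h := ((hcos.const_mul (s ^ 2 - 1)).const_add (s ^ 2 + 1)).div_const (2 * s)
  refine h.congr_deriv ?_
  have hs0 : s ≠ 0 := hs.ne'
  field_simp
  ring

/-- **Chain rule, second order** (the engine's `ω_xx∘X = (D/2s)² g_θθ − ((s² − 1) sin θ D/(4s²)) g_θ`): if `g′` has derivative `g″` at
`θ = Θ_s(y)`, then the first-derivative expression `y ↦ (D(Θ_s y)/(2s)) · g′(Θ_s y)` (= `(g ∘ Θ_s)′` by `hasDerivAt_comp_moebiusAngle`) has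
derivative `(D(θ)/(2s))² g″ − ((s² − 1) sin θ D(θ)/(4s²)) g′(θ)` at `y` (`s > 0`, `cos(y/2) ≠ 0`). [folklore] -/
theorem hasDerivAt_deriv_comp_moebiusAngle {s y : ℝ} (hs : 0 < s) (hy : Real.cos (y / 2) ≠ 0) {g' : ℝ → ℝ} {g'' : ℝ}
    (hg : HasDerivAt g' g'' (moebiusAngle s y)) :
    HasDerivAt (fun x => ((s ^ 2 + 1) + (s ^ 2 - 1) * Real.cos (moebiusAngle s x)) / (2 * s) * g' (moebiusAngle s x))
      ((((s ^ 2 + 1) + (s ^ 2 - 1) * Real.cos (moebiusAngle s y)) / (2 * s)) ^ 2 * g''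
        - (s ^ 2 - 1) * Real.sin (moebiusAngle s y) * ((s ^ 2 + 1) + (s ^ 2 - 1) * Real.cos (moebiusAngle s y))
            / (4 * s ^ 2) * g' (moebiusAngle s y)) y := by
  have h1 := hasDerivAt_engineDenom_comp hs hy
  have h2 := hasDerivAt_comp_moebiusAngle hs hy hg
  have h := h1.mul h2
  refine h.congr_deriv ?_
  ring

/-! ### The inverse map `X − x_c = Θ_{1/s}` and its derivatives -/

/-- **The inverse map is `Θ_{1/s}`**: `Θ_s(Θ_{s⁻¹}(θ)) = θ` for `θ ∈ (−π, π)` and `s ≠ 0` (so `x = x_c + Θ_{s⁻¹}(θ)` is the engine's `X(θ)`).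
[folklore] -/
theorem moebiusAngle_inv_comp {s : ℝ} (hs : s ≠ 0) {θ : ℝ} (hθ : θ ∈ Ioo (-π) π) :
    moebiusAngle s (moebiusAngle s⁻¹ θ) = θ := by
  unfold moebiusAngle
  rw [show 2 * Real.arctan (s⁻¹ * Real.tan (θ / 2)) / 2 = Real.arctan (s⁻¹ * Real.tan (θ / 2)) by ring, Real.tan_arctan,
    show s * (s⁻¹ * Real.tan (θ / 2)) = Real.tan (θ / 2) by field_simp,
    Real.arctan_tan (by linarith [hθ.1]) (by linarith [hθ.2])]
  ring

/-- **`X′(θ) = 2s/D(θ)`** (the engine's `(u∘X)_θ = (u_x∘X)·2s/D`): for `s > 0` and `cos(θ/2) ≠ 0`,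
`HasDerivAt (moebiusAngle s⁻¹) (2s/((s² + 1) + (s² − 1) cos θ)) θ`. [folklore] -/
theorem hasDerivAt_moebiusAngle_inv {s θ : ℝ} (hs : 0 < s) (hθ : Real.cos (θ / 2) ≠ 0) :
    HasDerivAt (moebiusAngle s⁻¹) (2 * s / ((s ^ 2 + 1) + (s ^ 2 - 1) * Real.cos θ)) θ := by
  refine (hasDerivAt_moebiusAngle (inv_pos.mpr hs) hθ).congr_deriv ?_
  have hs0 : s ≠ 0 := hs.ne'
  have hD : (s ^ 2 + 1) + (s ^ 2 - 1) * Real.cos θ ≠ 0 := by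
    have h := moebiusDenom_pos (inv_pos.mpr hs) θ
    have : (1 + s⁻¹ ^ 2) + (1 - s⁻¹ ^ 2) * Real.cos θ = ((s ^ 2 + 1) + (s ^ 2 - 1) * Real.cos θ) / s ^ 2 := by
      field_simp
    rw [this] at h
    exact (div_pos_iff_of_pos_right (by positivity)).mp h |>.ne'
  field_simp

/-- Chain rule through the inverse map (the engine's `(u∘X)_θ = (u_x∘X) · 2s/D`): if `u` has derivative `u′` at `x = Θ_{s⁻¹}(θ)` then
`θ ↦ u(Θ_{s⁻¹} θ)` has derivative `u′ · 2s/D(θ)` (`s > 0`, `cos(θ/2) ≠ 0`). [folklore] -/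
theorem hasDerivAt_comp_moebiusAngle_inv {s θ : ℝ} (hs : 0 < s) (hθ : Real.cos (θ / 2) ≠ 0) {u : ℝ → ℝ} {u' : ℝ}
    (hu : HasDerivAt u u' (moebiusAngle s⁻¹ θ)) :
    HasDerivAt (fun t => u (moebiusAngle s⁻¹ t)) (u' * (2 * s / ((s ^ 2 + 1) + (s ^ 2 - 1) * Real.cos θ))) θ :=
  hu.comp θ (hasDerivAt_moebiusAngle_inv hs hθ)

/-- **Derivative of the map in the parameter** (the moving map of the engine): `∂_s Θ_{s⁻¹}(θ) = −2 sin θ/D(θ)` for `s > 0`, `cos(θ/2) ≠ 0`;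
with `ω_x∘X = (D/2s) g_θ` this gives the transport term `(ω_x∘X)·ṡ ∂_s X = −g_θ sin θ (ṡ/s)` of ENGINE-E5 §11. [folklore] -/
theorem hasDerivAt_moebiusAngle_inv_param {s θ : ℝ} (hs : 0 < s) (hθ : Real.cos (θ / 2) ≠ 0) :
    HasDerivAt (fun σ : ℝ => moebiusAngle σ⁻¹ θ) (-2 * Real.sin θ / ((s ^ 2 + 1) + (s ^ 2 - 1) * Real.cos θ)) s := by
  obtain ⟨hc, hsn⟩ := half_angle θ
  set C := Real.cos (θ / 2) with hC
  set S := Real.sin (θ / 2) with hS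
  have hCS : S ^ 2 + C ^ 2 = 1 := Real.sin_sq_add_cos_sq (θ / 2)
  have htan : Real.tan (θ / 2) = S / C := Real.tan_eq_sin_div_cos _
  have hs0 : s ≠ 0 := hs.ne'
  -- `σ ↦ 2 arctan(σ⁻¹ t)`
  have e : (fun σ : ℝ => moebiusAngle σ⁻¹ θ) = fun σ => 2 * Real.arctan (σ⁻¹ * Real.tan (θ / 2)) := by
    funext σ; rfl
  rw [e]
  have h1 : HasDerivAt (fun σ : ℝ => σ⁻¹ * Real.tan (θ / 2)) (-(s ^ 2)⁻¹ * Real.tan (θ / 2)) s :=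
    (hasDerivAt_inv hs0).mul_const _
  have h2 := (h1.arctan).const_mul 2
  refine h2.congr_deriv ?_
  rw [htan, hc, hsn]
  have hden : (s ^ 2 + 1) + (s ^ 2 - 1) * (C ^ 2 - S ^ 2) = 2 * (s ^ 2 * C ^ 2 + S ^ 2) := by
    linear_combination (-(s ^ 2 + 1)) * hCS
  rw [hden]
  have hC2 : s ^ 2 * C ^ 2 + S ^ 2 ≠ 0 := by positivity
  field_simp

end Summit.NavierStokesRegularity.OSWSelfSimilar.MoebiusAngleChainRule
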